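import Summits.Ventures.DiscreteObjects.Hadamard.NormalizingPermTools
import Summits.Ventures.DiscreteObjects.Hadamard.Order167CirculantArray668

/-!
# Tools for normalisers of prime-order elements: orbit relation, recentring in a prime field, and the `c!`-power of a
# normalising permutation preserves the `c` orbits (kernel, general)

Framing: lottery ticket; floor = certified bounds/negative ranges.

Cell pub-namedobj (venture DiscreteObjects), target (H), hadamard gen 20.  General lemmas behind the order-167 and order-83
normaliser theorems (`Order167Normalizer668`, `Order167NormalizerBlocks668`, `Order83Normalizer668`).  For a permutation `κ` with
`κ ^ p = 1`: the orbit relation `z ∈ orbFin κ p y` is symmetric and transitive and is preserved by any `ψ` with `ψ κ = κ^μ ψ`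
(`orbFin_symm'`, `orbFin_trans'`, `orbFin_map'`); transversal bookkeeping for a general period (`exists_rep_of_moved_n`,
`pow_eq_pow_of_natCast_eq_n`); powers of a normalising permutation normalise with multiplier `μ^a` (`norm_pow_left`); in a prime
field `ZMod p` a translation-twisted `u`-invariant sequence with `u ≠ 1` has a `u`-invariant translate
(`exists_translate_hInvariant_prime`, the fixed point of the affine map); and the combinatorial heart
**`norm_pow_factorial_mem_orbFin`**: if `p` is prime, `κ ^ p = 1`, `κ ≠ 1`, `ψ κ = κ^μ ψ` and `T` is a transversal of the `κ`-orbits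
on the moved points, then `ψ ^ (|T|!)` maps every moved point into its own `κ`-orbit [`ψ` permutes the orbits: it induces an
injective self-map of `T`, a permutation `g` of a `|T|`-set, and `g ^ |Sym T| = 1` (`pow_card_eq_one`)].  Ours (elementary);
no `sorry`, no definitions.
-/

namespace Summit.Ventures.DiscreteObjects.Hadamard

open Finset BigOperators

open Literature.Combinatorics.Designs.LegendrePairs (TwistedInvariant HInvariant)

variable {ι : Type*} [Fintype ι] [DecidableEq ι]

/-! ### transversal bookkeeping for a general period -/

/-- every moved point lies on the `π`-cycle of a transversal element (general period `n`) -/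
lemma exists_rep_of_moved_n (π : Equiv.Perm ι) {n : ℕ} (T : Finset ι)
    (hT : ∀ f : ι → ℤ, ∑ y ∈ univ.filter (fun y => π y ≠ y), f y = ∑ t ∈ T, ∑ k ∈ Finset.range n, f ((π ^ k) t))
    {x : ι} (hx : π x ≠ x) : ∃ t ∈ T, ∃ k, k < n ∧ (π ^ k) t = x := by
  have h1 := card_orbitMap_fibre_eq_one π T (univ.filter fun y => π y ≠ y) hT
    (Finset.mem_filter.mpr ⟨Finset.mem_univ _, hx⟩)
  obtain ⟨q, hq⟩ := Finset.card_pos.mp (by rw [h1]; norm_num)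
  rw [Finset.mem_filter, Finset.mem_product, Finset.mem_range] at hq
  exact ⟨q.1, hq.1.1, q.2, hq.1.2, hq.2⟩

omit [Fintype ι] [DecidableEq ι] in
/-- powers of `κ` with congruent exponents mod `n` agree when `κ ^ n = 1` -/
lemma pow_eq_pow_of_natCast_eq_n {κ : Equiv.Perm ι} {n : ℕ} (hκ : κ ^ n = 1) {m m' : ℕ}
    (h : (m : ZMod n) = (m' : ZMod n)) : κ ^ m = κ ^ m' := by
  rw [ZMod.natCast_eq_natCast_iff'] at h
  rw [← pow_mod_of_pow_eq_one κ hκ m, ← pow_mod_of_pow_eq_one κ hκ m', h]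

/-! ### powers of a normalising permutation -/

omit [Fintype ι] [DecidableEq ι] in
/-- `ψ^a π = π^(μ^a) ψ^a`: powers of a normalising permutation normalise, with multiplier `μ^a` -/
lemma norm_pow_left {π ψ : Equiv.Perm ι} {μ : ℕ} (hn : ψ * π = π ^ μ * ψ) (a : ℕ) :
    ψ ^ a * π = π ^ (μ ^ a) * ψ ^ a := by
  induction a with
  | zero => simp
  | succ a ih =>
    rw [pow_succ' ψ a, mul_assoc, ih, ← mul_assoc, norm_comm_pow hn (μ ^ a), mul_assoc, ← pow_succ' μ a]

/-! ### the orbit relation for a permutation with `κ ^ p = 1` -/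

section orbits
variable {κ : Equiv.Perm ι} {p : ℕ} (hp : 0 < p) (hκ : κ ^ p = 1)
include hp hκ

omit [Fintype ι] in
/-- symmetry of the orbit relation -/
lemma orbFin_symm' {y z : ι} (h : z ∈ orbFin κ p y) : y ∈ orbFin κ p z := by
  obtain ⟨m, hm, hz⟩ := Finset.mem_image.mp h
  rw [Finset.mem_range] at hm
  have hzp : (κ ^ p) z = z := by rw [hκ, Equiv.Perm.one_apply]
  have e : y = (κ ^ (p - m)) z := by
    rw [← hz, ← Equiv.Perm.mul_apply, ← pow_add, show p - m + m = p by omega, hκ, Equiv.Perm.one_apply]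
  rw [e]; exact pow_apply_mem_orbFin_of_fixed κ hp hzp _

omit [Fintype ι] in
/-- transitivity of the orbit relation: `a ∈ orb b`, `b ∈ orb c` ⇒ `a ∈ orb c` -/
lemma orbFin_trans' {a b c : ι} (hab : a ∈ orbFin κ p b) (hbc : b ∈ orbFin κ p c) : a ∈ orbFin κ p c := by
  obtain ⟨m, -, ha⟩ := Finset.mem_image.mp hab
  obtain ⟨m', -, hb⟩ := Finset.mem_image.mp hbc
  have hcp : (κ ^ p) c = c := by rw [hκ, Equiv.Perm.one_apply]
  have e : a = (κ ^ (m + m')) c := by rw [← ha, ← hb, ← Equiv.Perm.mul_apply, ← pow_add]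
  rw [e]; exact pow_apply_mem_orbFin_of_fixed κ hp hcp _

omit [Fintype ι] in
/-- a normalising permutation maps orbits into orbits -/
lemma orbFin_map' {ψ : Equiv.Perm ι} {μ : ℕ} (hn : ψ * κ = κ ^ μ * ψ) {y z : ι} (h : z ∈ orbFin κ p y) :
    ψ z ∈ orbFin κ p (ψ y) := by
  obtain ⟨m, -, hz⟩ := Finset.mem_image.mp h
  have hyp : (κ ^ p) (ψ y) = ψ y := by rw [hκ, Equiv.Perm.one_apply]
  rw [← hz, norm_apply_pow hn m y]
  exact pow_apply_mem_orbFin_of_fixed κ hp hyp _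

end orbits

/-! ### recentring in a prime field -/

/-- **recentring** (`p` prime): a translation-twisted `u`-invariant sequence on `ZMod p` with `u ≠ 1` has a `u`-invariant
translate — translate by the fixed point of the affine map `i ↦ u⁻¹ i + c`. -/
theorem exists_translate_hInvariant_prime {p : ℕ} [Fact p.Prime] (x : ZMod p → ℤ) (u : (ZMod p)ˣ)
    (hu1 : (u : ZMod p) ≠ 1) (h : TwistedInvariant x u) :
    ∃ δ : ZMod p, HInvariant (Literature.Combinatorics.Designs.LegendrePairs.translate x δ) u := by
  obtain ⟨c, hc⟩ := h
  set v : ZMod p := ((u⁻¹ : (ZMod p)ˣ) : ZMod p) with hv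
  have huv : (u : ZMod p) * v = 1 := Units.mul_inv u
  have hne : (1 : ZMod p) - v ≠ 0 := by
    intro h0; apply hu1
    have h1 : v = 1 := by linear_combination -h0
    rw [← huv, h1, mul_one]
  refine ⟨c * ((1 : ZMod p) - v)⁻¹, fun i => ?_⟩
  unfold Literature.Combinatorics.Designs.LegendrePairs.translate
  have e : (u : ZMod p) * i + c * ((1 : ZMod p) - v)⁻¹ =
      (u : ZMod p) * (i + v * (c * ((1 : ZMod p) - v)⁻¹)) := by
    rw [mul_add, ← mul_assoc, huv, one_mul]
  rw [e, hc]
  congr 1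
  have h1 : ((1 : ZMod p) - v) * ((1 : ZMod p) - v)⁻¹ = 1 := mul_inv_cancel₀ hne
  rw [add_assoc]
  congr 1
  linear_combination (-c) * h1

/-! ### the `|T|!`-th power of a normalising permutation preserves the orbits -/

/-- **`ψ ^ (|T|!)` preserves the blocks.**  `p` prime, `κ ^ p = 1`, `κ ≠ 1`, `ψ κ = κ^μ ψ`, `T` a transversal of the
`κ`-orbits on the moved points (`Σ_{κ y ≠ y} f y = Σ_{t∈T} Σ_{k<p} f (κ^k t)` for all `f`): then `ψ ^ (T.card)!` maps every moved
point into its own `κ`-orbit. -/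
theorem norm_pow_factorial_mem_orbFin {κ ψ : Equiv.Perm ι} {p μ : ℕ} (hp : p.Prime) (hn : ψ * κ = κ ^ μ * ψ)
    (hκ : κ ^ p = 1) (hne : κ ≠ 1) (T : Finset ι) (hTsub : T ⊆ univ.filter (fun y => κ y ≠ y))
    (hT : ∀ f : ι → ℤ, ∑ y ∈ univ.filter (fun y => κ y ≠ y), f y = ∑ t ∈ T, ∑ k ∈ Finset.range p, f ((κ ^ k) t)) :
    ∀ y, κ y ≠ y → (ψ ^ (T.card).factorial) y ∈ orbFin κ p y := by
  have hp0 : 0 < p := hp.pos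
  -- moved points: orbits of moved points are moved; ψ maps moved to moved
  have hmovedpow : ∀ y, κ y ≠ y → ∀ k, κ ((κ ^ k) y) ≠ (κ ^ k) y := by
    intro y hy k h
    rw [← Equiv.Perm.mul_apply, ← pow_succ', pow_succ, Equiv.Perm.mul_apply] at h
    exact hy ((κ ^ k).injective h)
  have hψmoved : ∀ y, κ y ≠ y → κ (ψ y) ≠ ψ y := fun y hy => by
    simpa only [pow_one] using norm_pow_moved hn 1 (by simpa only [pow_one] using hy)
  -- the multiplier is invertible mod p
  have hndvd : ¬ p ∣ μ := by
    rintro ⟨m, rfl⟩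
    apply hne
    have h1 := hn
    rw [pow_mul, hκ, one_pow, one_mul] at h1
    have h2 : ψ * κ = ψ * 1 := by rw [h1, mul_one]
    exact mul_left_cancel h2
  have hcop : Nat.Coprime μ p := ((Nat.Prime.coprime_iff_not_dvd hp).mpr hndvd).symm
  obtain ⟨ν, -, hν⟩ := Nat.exists_mul_mod_eq_one_of_coprime hcop hp.one_lt
  -- representatives of moved points
  have hrep : ∀ y, κ y ≠ y → ∃ t ∈ T, y ∈ orbFin κ p t := by
    intro y hy
    obtain ⟨t, htT, k, hk, hty⟩ := exists_rep_of_moved_n κ T hT hy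
    have htp : (κ ^ p) t = t := by rw [hκ, Equiv.Perm.one_apply]
    exact ⟨t, htT, by rw [← hty]; exact pow_apply_mem_orbFin_of_fixed κ hp0 htp _⟩
  have hTmoved : ∀ t ∈ T, κ t ≠ t := fun t ht => (Finset.mem_filter.mp (hTsub ht)).2
  -- two transversal elements in one orbit coincide
  have huniq : ∀ t ∈ T, ∀ t' ∈ T, t' ∈ orbFin κ p t → t = t' := by
    intro t ht t' ht' hmem
    obtain ⟨m, hm, hmt⟩ := Finset.mem_image.mp hmem
    rw [Finset.mem_range] at hm
    have h2 : (κ ^ m) t = (κ ^ 0) t' := by rw [hmt, pow_zero, Equiv.Perm.one_apply]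
    have hY : (κ ^ m) t ∈ univ.filter (fun y => κ y ≠ y) :=
      Finset.mem_filter.mpr ⟨Finset.mem_univ _, hmovedpow t (hTmoved t ht) m⟩
    exact (orbitMap_unique κ T _ hT ht ht' hm hp0 hY h2).1
  -- the induced self-map of the transversal (on the subtype)
  have hrepT : ∀ t : {t // t ∈ T}, ∃ r ∈ T, ψ t.1 ∈ orbFin κ p r := fun t => hrep _ (hψmoved _ (hTmoved _ t.2))
  choose rep hrepT hrepmem using hrepT
  set f : {t // t ∈ T} → {t // t ∈ T} := fun t => ⟨rep t, hrepT t⟩ with hfdef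
  have hf : ∀ t : {t // t ∈ T}, ψ t.1 ∈ orbFin κ p (f t).1 := fun t => hrepmem t
  have hfiter : ∀ k : ℕ, ∀ t : {t // t ∈ T}, (ψ ^ k) t.1 ∈ orbFin κ p (f^[k] t).1 := by
    intro k; induction k with
    | zero => intro t; simpa using mem_orbFin_self κ hp0 t.1
    | succ k ih =>
      intro t
      rw [pow_succ', Equiv.Perm.mul_apply, Function.iterate_succ_apply']
      exact orbFin_trans' hp0 hκ (orbFin_map' hp0 hκ hn (ih t)) (hf _)
  have hinj : Function.Injective f := by
    intro t t' heq
    have h1 : ψ t.1 ∈ orbFin κ p (f t).1 := hf t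
    have h2 : ψ t'.1 ∈ orbFin κ p (f t).1 := by rw [heq]; exact hf t'
    have h3 : ψ t'.1 ∈ orbFin κ p (ψ t.1) := orbFin_trans' hp0 hκ h2 (orbFin_symm' hp0 hκ h1)
    obtain ⟨m, -, hm⟩ := Finset.mem_image.mp h3
    have hμν : (μ : ZMod p) * (ν : ZMod p) = 1 := by
      rw [← Nat.cast_mul, ← ZMod.natCast_mod, hν, Nat.cast_one]
    have e : (κ ^ m) (ψ t.1) = ψ ((κ ^ (ν * m)) t.1) := by
      rw [norm_apply_pow hn (ν * m) t.1]
      congr 1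
      apply pow_eq_pow_of_natCast_eq_n hκ
      push_cast
      rw [← mul_assoc, hμν, one_mul]
    rw [e] at hm
    have hm' : (κ ^ (ν * m)) t.1 = t'.1 := ψ.injective hm
    have htp : (κ ^ p) t.1 = t.1 := by rw [hκ, Equiv.Perm.one_apply]
    have hmem : t'.1 ∈ orbFin κ p t.1 := by rw [← hm']; exact pow_apply_mem_orbFin_of_fixed κ hp0 htp _
    exact Subtype.ext (huniq t.1 t.2 t'.1 t'.2 hmem)
  -- as a permutation of the finite set T: g ^ |Sym T| = 1
  set g : Equiv.Perm {t // t ∈ T} := Equiv.ofBijective f (Finite.injective_iff_bijective.mp hinj) with hgdef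
  have hgpow : ∀ k : ℕ, ∀ t, (g ^ k) t = f^[k] t := by
    intro k; induction k with
    | zero => intro t; simp
    | succ k ih => intro t; rw [pow_succ', Equiv.Perm.mul_apply, ih, Function.iterate_succ_apply']; rfl
  have hcardG : Fintype.card (Equiv.Perm {t // t ∈ T}) = (T.card).factorial := by
    rw [Fintype.card_perm, Fintype.card_coe]
  have hgfac : g ^ (T.card).factorial = 1 := by rw [← hcardG]; exact pow_card_eq_one
  have hTfac : ∀ t : {t // t ∈ T}, (ψ ^ (T.card).factorial) t.1 ∈ orbFin κ p t.1 := by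
    intro t
    have h := hfiter (T.card).factorial t
    rwa [← hgpow, hgfac, Equiv.Perm.one_apply] at h
  -- general moved point
  intro y hy
  obtain ⟨t, htT, hyt⟩ := hrep y hy
  have hnF := norm_pow_left hn (T.card).factorial
  have h1 : (ψ ^ (T.card).factorial) y ∈ orbFin κ p ((ψ ^ (T.card).factorial) t) := orbFin_map' hp0 hκ hnF hyt
  have h2 : (ψ ^ (T.card).factorial) t ∈ orbFin κ p t := hTfac ⟨t, htT⟩
  exact orbFin_trans' hp0 hκ (orbFin_trans' hp0 hκ h1 h2) (orbFin_symm' hp0 hκ hyt)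

end Summit.Ventures.DiscreteObjects.Hadamard
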